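import Summits.ValiantsHypothesis.ValiantsHypothesis.Theorems.DefinabilityGapK1ConstDepthRung
import Literature.Computability.AlgebraicComplexity.HomDepthFourNormalForm
import Literature.Computability.AlgebraicComplexity.ArithCircuitComposition
import HarnessLib

/-!
# Depth4 — rung one in the door's own currency: `(n+2)^a < homDepthFourCircuitSize per_n`
# (support for crux `Depth4HomFour` = item `stmt-ValiantsHypothesis-11333`; lens 4, g28)

The crux `Depth4HomFour` of route `Depth4` asks, in the measure `homDepthFourCircuitSize` (GATES
of homogeneous `ΣΠΣΠ` circuits of unbounded fan-in, `ArithCircuit.IsDepthFour`), for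
`∀ c, ∃ n, (n+2 : ℕ∞)^(c * Nat.sqrt n + c) < homDepthFourCircuitSize (perPoly (Fin n) ℂ)`.
So far the tree had no unconditional lower bound on that measure for any family: the LST rungs
for the permanent (`perHardConstDepth`, `perHard_io`) bound the WIRES (`edgeSize`) at
product-depth `≤ Δ`, and at unbounded fan-in gates do not bound wires. This file transfers them
through the Kumar–Saraf normal form `ArithCircuit.exists_sum_prod` [KS17, §3 (3.1)] rebuilt at
product-depth 2 with polynomially many wires (`exists_productDepth_two_of_homDepthFour`, via
`ArithCircuit.compose`): `homDepthFour_perPoly_io` is RUNG ONE `∀ a m₀, ∃ n ≥ m₀,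
(n+2 : ℕ∞)^a < homDepthFourCircuitSize (perPoly (Fin n) ℂ)` (`perHard_io` [LST25, Cor. 4]),
`homDepthFour_perPoly_gt_pow` the crux's binder shape at constant slope, and
`exists_circuit_of_homDepthFourCircuitSize_le` the previously missing extraction lemma for the
measure (after `LSTSlice.exists_circuit_of_productDepthCircuitSize_le`).

HONEST READING. VP-saturated rung one (every fixed polynomial slope); IMM/det obey the same
bound; 0 S-currency; crux 11333 needs slope c·√n; nothing here bears on VP ≠ VNP. The
mathematics is known (LST transported to `per` = the tree's `perHard_io`, the Kumar–Saraf normal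
form, a folklore gates-to-wires rebuild); new in the tree is only the first lower bound on the
door's own measure. In print, homogeneous-`ΣΠΣΠ` lower bounds for `per_n`/`det_n` stand at
`2^{Ω(n^ε)}` [KS14, Cor. 1.4]. No `def`, no named fact.
References: [KS17] M. Kumar, S. Saraf, *On the power of homogeneous depth 4 arithmetic circuits*,
SIAM J. Comput. 46 (2017), §3 (bib: KumarSaraf2017); [LST25] N. Limaye, S. Srinivasan,
S. Tavenas, *Superpolynomial lower bounds against low-depth algebraic circuits*, J. ACM 2025 /
FOCS 2021, Cor. 4 (bib: LimayeSrinivasanTavenas2025); [KS14] M. Kumar, S. Saraf, *The limits of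
depth reduction for arithmetic formulas*, STOC 2014, Cor. 1.4.
-/

set_option linter.dupNamespace false

noncomputable section

open MvPolynomial
open Literature.Computability.AlgebraicComplexity

namespace Summit.ValiantsHypothesis.ValiantsHypothesis.Theorems.Depth4HomFourRung

section WireNormalForm

variable {K : Type} [CommRing K] {σ : Type} [Fintype σ] [DecidableEq σ]

/-- Exponent vectors of degree `≤ 1` are `0` or some `single i 1`. [folklore] -/
theorem card_filter_degree_le_one_le (S : Finset (σ →₀ ℕ)) :
    (S.filter fun β => β.degree ≤ 1).card ≤ Fintype.card σ + 1 := by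
  have hsub : (S.filter fun β => β.degree ≤ 1) ⊆
      insert 0 (Finset.univ.image fun i : σ => Finsupp.single i 1) := by
    intro β hβ
    rw [Finset.mem_insert, Finset.mem_image]
    rcases Nat.le_one_iff_eq_zero_or_eq_one.mp (Finset.mem_filter.mp hβ).2 with h0 | h1
    · exact Or.inl ((Finsupp.degree_eq_zero_iff β).mp h0)
    · have hβ1 : β ∈ Set.range fun a : σ => Finsupp.single a 1 := by
        rw [Finsupp.range_single_one]
        exact h1
      exact Or.inr (hβ1.imp fun i hi => ⟨Finset.mem_univ _, hi⟩)
  exact (Finset.card_le_card hsub).trans ((Finset.card_insert_le _ _).trans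
    (Nat.add_le_add_right (Finset.card_image_le.trans Finset.card_univ.le) 1))

/-- A bottom factor of `P` (Kumar–Saraf's `Q_{ij}`) has at most `size P + #σ + 1` monomials.
[cite: KumarSaraf2017, §3] -/
theorem card_support_le_of_isBottomFactor {P : ArithCircuit K σ} {g : MvPolynomial σ K}
    (hg : P.IsBottomFactor g) : g.support.card ≤ P.size + (Fintype.card σ + 1) := by
  have hsub : g.support ⊆ P.monoExps ∪ g.support.filter (fun β => β.degree ≤ 1) := by
    intro β hβ
    rcases hg β hβ with h | h
    · exact Finset.mem_union_left _ h
    · exact Finset.mem_union_right _ (Finset.mem_filter.mpr ⟨hβ, h⟩)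
  exact (Finset.card_le_card hsub).trans ((Finset.card_union_le _ _).trans
    (Nat.add_le_add P.card_monoExps_le (card_filter_degree_le_one_le _)))

/-- Wire bookkeeping of the rebuild. [folklore] -/
theorem wires_bound {s N d Qc A B : ℕ} (hQ : Qc ≤ s) (hd : 2 ≤ d) (hA : A ≤ Qc * (d + 1))
    (hB : B ≤ Qc * d * ((s + (N + 1)) * (d + 1))) :
    A + B ≤ ((s + N + 1) * (d + 2)) ^ 3 := by
  have key : ∀ X, 2 ≤ X → A ≤ X → B ≤ X * X → A + B ≤ X ^ 3 := fun X h2 ha hb => by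
    have h1 : 2 * X ≤ X * X := Nat.mul_le_mul_right _ h2
    have h3 : 2 * (X * X) ≤ X * (X * X) := Nat.mul_le_mul_right _ h2
    calc A + B ≤ X + X * X := Nat.add_le_add ha hb
      _ ≤ X * (X * X) := by linarith
      _ = X ^ 3 := by ring
  refine key _ ?_ (hA.trans (Nat.mul_le_mul (by omega) (by omega)))
    (hB.trans (Nat.mul_le_mul (Nat.mul_le_mul (by omega) (by omega))
      (Nat.mul_le_mul (by omega) (by omega))))
  calc 2 ≤ 1 * (d + 2) := by omega
    _ ≤ (s + N + 1) * (d + 2) := Nat.mul_le_mul_right _ (by omega)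

/-- **Wire normal form of homogeneous `ΣΠΣΠ` circuits**: a homogeneous depth-4 circuit `P`
(unbounded fan-in, `size` = gates) for `f`, homogeneous of degree `d ≥ 2`, yields a
product-depth-`≤ 2` circuit for `f` with at most `((size P + #σ + 1)·(d + 2))³` WIRES (the
Kumar–Saraf normal form `ArithCircuit.exists_sum_prod`, constants folded into the coefficients,
rebuilt by `ArithCircuit.compose`). [cite: KumarSaraf2017, §3 eq. (3.1)] -/
theorem exists_productDepth_two_of_homDepthFour {P : ArithCircuit K σ} {f : MvPolynomial σ K}
    {d : ℕ} (hc : P.Computes f) (h4 : P.IsDepthFour) (hh : P.IsHomogeneousCircuit)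
    (hf : f.IsHomogeneous d) (hd : 2 ≤ d) :
    ∃ C : ArithCircuit K σ, C.Computes f ∧ C.productDepth ≤ 2 ∧
      C.edgeSize ≤ ((P.size + Fintype.card σ + 1) * (d + 2)) ^ 3 := by
  classical
  rcases subsingleton_or_nontrivial K with hK | hK
  · -- over the trivial ring `f = 0` and the empty `ΣΠ` circuit does it
    obtain ⟨C, h1, h2, h3⟩ := DepthThreeChasm.exists_sumOfMonomials_circuit f
    have hf0 : f = 0 := MvPolynomial.ext _ _ fun m => Subsingleton.elim _ _
    exact ⟨C, h1, h2.trans one_le_two, h3.trans (by simp [hf0])⟩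
  obtain ⟨Q, c, hQcard, hfsum, hQ⟩ := ArithCircuit.exists_sum_prod hc h4 hh hf hd
  choose L hL hqL using fun q : ↥Q => (hQ q.1 q.2).2.2
  obtain ⟨g, hg⟩ : ∃ g : (q : ↥Q) → Fin (L q).length → MvPolynomial σ K,
      ∀ q j, g q j = (L q).get j := ⟨_, fun _ _ => rfl⟩
  have hprod : ∀ q : ↥Q, (q : MvPolynomial σ K) = ∏ j, g q j := fun q => by
    rw [hqL q]; simp only [hg, List.get_eq_getElem, Fin.prod_univ_getElem]
  have hL' : ∀ (q : ↥Q) (j : Fin (L q).length),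
      P.IsBottomFactor (g q j) ∧ ∃ e, (g q j).IsHomogeneous e := fun q j =>
    hL q _ (by rw [hg]; exact List.get_mem _ _)
  have hne : ∀ (q : ↥Q) (j : Fin (L q).length), g q j ≠ 0 := fun q j h0 =>
    (hQ q.1 q.2).1 (by rw [hprod q]; exact Finset.prod_eq_zero (Finset.mem_univ j) h0)
  have hhom : ∀ (q : ↥Q) (j : Fin (L q).length), (g q j).IsHomogeneous (g q j).totalDegree :=
    fun q j => by obtain ⟨e, he⟩ := (hL' q j).2; rwa [he.totalDegree (hne q j)]
  have hdeg : ∀ q : ↥Q, ∑ j, (g q j).totalDegree = d := fun q => by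
    have h1 : (q : MvPolynomial σ K).IsHomogeneous (∑ j, (g q j).totalDegree) := by
      rw [hprod q]
      exact IsHomogeneous.prod _ _ _ fun j _ => hhom q j
    exact h1.inj_right (hQ q.1 q.2).2.1 (hQ q.1 q.2).1
  have hdegle : ∀ (q : ↥Q) (j : Fin (L q).length), (g q j).totalDegree ≤ d := fun q j => by
    rw [← hdeg q]
    exact Finset.single_le_sum (f := fun j => (g q j).totalDegree) (fun _ _ => Nat.zero_le _)
      (Finset.mem_univ j)
  have hcardS : ∀ q : ↥Q,
      Fintype.card {j : Fin (L q).length // 0 < (g q j).totalDegree} ≤ d := fun q => by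
    rw [Fintype.card_subtype, Finset.card_eq_sum_ones, ← hdeg q]
    have h1 : ∑ _j ∈ Finset.univ.filter (fun j : Fin (L q).length => 0 < (g q j).totalDegree), 1
        ≤ ∑ j ∈ Finset.univ.filter (fun j : Fin (L q).length => 0 < (g q j).totalDegree),
          (g q j).totalDegree :=
      Finset.sum_le_sum fun j hj => Nat.one_le_of_lt (Finset.mem_filter.mp hj).2
    exact h1.trans (Finset.sum_le_sum_of_subset (Finset.filter_subset _ _))
  have hcardτ : Fintype.card (Σ q : ↥Q, {j : Fin (L q).length // 0 < (g q j).totalDegree})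
      ≤ Fintype.card ↥Q * d := by
    rw [Fintype.card_sigma]
    exact (Finset.sum_le_sum fun q _ => hcardS q).trans
      (le_of_eq (by rw [Finset.sum_const, Finset.card_univ, smul_eq_mul]))
  obtain ⟨z, hz⟩ : ∃ z : ↥Q → K, ∀ q, z q =
      ∏ j ∈ Finset.univ.filter (fun j : Fin (L q).length => ¬ 0 < (g q j).totalDegree),
        coeff 0 (g q j) := ⟨_, fun _ => rfl⟩
  have hsplit : ∀ q : ↥Q, (q : MvPolynomial σ K) =
      (∏ j : {j : Fin (L q).length // 0 < (g q j).totalDegree}, g q j.1) * C (z q) := by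
    intro q
    rw [hprod q, ← Finset.prod_filter_mul_prod_filter_not Finset.univ
      (fun j : Fin (L q).length => 0 < (g q j).totalDegree)]
    congr 1
    · exact Finset.prod_subtype _ (fun j => by simp) _
    · rw [hz q, map_prod]
      exact Finset.prod_congr rfl fun j hj =>
        totalDegree_eq_zero_iff_eq_C.mp (Nat.eq_zero_of_not_pos (Finset.mem_filter.mp hj).2)
  have h_outer : ∀ {α : Type} [Fintype α] {β : α → Type} [∀ a, Fintype (β a)]
      (b : α → K) {e : ℕ}, (∀ a, Fintype.card (β a) ≤ e) →
      ∃ C : ArithCircuit K (Σ a, β a), C.Computes (∑ a : α, b a • ∏ j : β a,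
        (X ⟨a, j⟩ : MvPolynomial (Σ a, β a) K)) ∧ C.productDepth ≤ 1 ∧
        C.edgeSize ≤ Fintype.card α * (e + 1) := by
    intro α _ β _ b e he
    have hmono : ∀ a : α, (∏ j : β a, (X ⟨a, j⟩ : MvPolynomial (Σ a, β a) K))
        = monomial (∑ j : β a, Finsupp.single (⟨a, j⟩ : Σ a, β a) 1) 1 := fun a =>
      ((monomial_sum_one _ _).trans (Finset.prod_congr rfl fun _ _ => rfl)).symm
    have hsupp : (∑ a : α, b a • ∏ j : β a,
        (X ⟨a, j⟩ : MvPolynomial (Σ a, β a) K)).support.card ≤ Fintype.card α := by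
      calc _ ≤ ∑ a : α, (b a • ∏ j : β a,
              (X ⟨a, j⟩ : MvPolynomial (Σ a, β a) K)).support.card :=
            (Finset.card_le_card support_sum).trans Finset.card_biUnion_le
        _ ≤ ∑ _a : α, 1 := Finset.sum_le_sum fun a _ => by
            rw [hmono a]
            exact (Finset.card_le_card (support_smul.trans support_monomial_subset)).trans
              (Finset.card_singleton _).le
        _ = Fintype.card α := by simp
    have hdegF : (∑ a : α, b a • ∏ j : β a,
        (X ⟨a, j⟩ : MvPolynomial (Σ a, β a) K)).totalDegree ≤ e := by
      refine totalDegree_finsetSum_le fun a _ => (totalDegree_smul_le _ _).trans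
        ((totalDegree_finsetProd _ _).trans ?_)
      calc ∑ j : β a, (X (⟨a, j⟩ : Σ a, β a) : MvPolynomial (Σ a, β a) K).totalDegree
          ≤ ∑ _j : β a, 1 := Finset.sum_le_sum fun j _ => (totalDegree_X (R := K) _).le
        _ = Fintype.card (β a) := by simp
        _ ≤ e := he a
    obtain ⟨C, h1, h2, h3⟩ := DepthThreeChasm.exists_sumOfMonomials_circuit
      (∑ a : α, b a • ∏ j : β a, (X ⟨a, j⟩ : MvPolynomial (Σ a, β a) K))
    exact ⟨C, h1, h2, h3.trans (Nat.mul_le_mul hsupp (Nat.succ_le_succ hdegF))⟩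
  obtain ⟨Cout, hCout, hCoutd, hCoute⟩ := h_outer
    (β := fun q : ↥Q => {j : Fin (L q).length // 0 < (g q j).totalDegree})
    (fun q : ↥Q => c q * z q) hcardS
  have hin : ∀ i : (Σ q : ↥Q, {j : Fin (L q).length // 0 < (g q j).totalDegree}),
      ∃ Cin : ArithCircuit K σ, Cin.Computes (g i.1 i.2.1) ∧ Cin.productDepth ≤ 1 ∧
        Cin.edgeSize ≤ (P.size + (Fintype.card σ + 1)) * (d + 1) := fun i => by
    obtain ⟨Cin, h1, h2, h3⟩ := DepthThreeChasm.exists_sumOfMonomials_circuit (g i.1 i.2.1)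
    exact ⟨Cin, h1, h2, h3.trans (Nat.mul_le_mul (card_support_le_of_isBottomFactor
      (hL' _ _).1) (Nat.succ_le_succ (hdegle _ _)))⟩
  choose Cin hCin hCind hCine using hin
  refine ⟨Cout.compose Cin, ?_, ?_, ?_⟩
  · -- it computes `∑_q (c_q z_q) ∏_j Q_{qj} = ∑_q c_q · q = f` (`Computes.compose`)
    have hSf : aeval (fun i : (Σ q : ↥Q, {j : Fin (L q).length // 0 < (g q j).totalDegree}) =>
        g i.1 i.2.1) (∑ q : ↥Q, (c q * z q) •
          ∏ j : {j : Fin (L q).length // 0 < (g q j).totalDegree}, (X ⟨q, j⟩ :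
            MvPolynomial (Σ q : ↥Q, {j : Fin (L q).length // 0 < (g q j).totalDegree}) K))
        = f := by
      simp only [map_sum, map_smul, map_prod, aeval_X]
      rw [hfsum, ← Finset.sum_coe_sort Q]
      refine Finset.sum_congr rfl fun q _ => ?_
      rw [hsplit q, mul_comm _ (C (z q)), ← smul_eq_C_mul, smul_smul]
    have hcomp := ArithCircuit.Computes.compose (g := fun i => g i.1 i.2.1) hCout hCin
    rw [hSf] at hcomp
    exact hcomp
  · exact (ArithCircuit.productDepth_compose_le hCind Cout).trans (by omega)
  · rw [ArithCircuit.edgeSize_compose]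
    refine wires_bound (by rw [Fintype.card_coe]; exact hQcard) hd hCoute
      ((Finset.sum_le_sum fun i _ => hCine i).trans ?_)
    rw [Finset.sum_const, smul_eq_mul, Finset.card_univ]
    exact Nat.mul_le_mul_right _ hcardτ

end WireNormalForm

/-- A finite bound on `homDepthFourCircuitSize f` is witnessed by a circuit (extraction lemma,
after `LSTSlice.exists_circuit_of_productDepthCircuitSize_le`). [folklore] -/
theorem exists_circuit_of_homDepthFourCircuitSize_le {K : Type} [CommSemiring K] {σ : Type}
    {f : MvPolynomial σ K} {m : ℕ} (h : homDepthFourCircuitSize f ≤ (m : ℕ∞)) :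
    ∃ P : ArithCircuit K σ, P.Computes f ∧ P.IsDepthFour ∧ P.IsHomogeneousCircuit ∧
      P.size ≤ m := by
  by_contra hno
  push Not at hno
  have hle : ((m + 1 : ℕ) : ℕ∞) ≤ homDepthFourCircuitSize f := by
    refine le_iInf₂ fun P hP => ?_
    exact_mod_cast Nat.succ_le_of_lt (hno P hP.1 hP.2.1 hP.2.2)
  have := ENat.coe_le_coe.mp (hle.trans h)
  omega

/-- Exponent bookkeeping: `((s + n² + 1)(n + 2))³ ≤ n^(6a+24)` for `s ≤ (n+2)^a`, `n ≥ 2`.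
[folklore] -/
theorem rung_arith {n a s : ℕ} (hn : 2 ≤ n) (hs : s ≤ (n + 2) ^ a) :
    ((s + n * n + 1) * (n + 2)) ^ 3 ≤ n ^ (6 * a + 24) := by
  have h2 : 0 < n + 2 := by omega
  have hsq2 : (n + 2) ^ 2 = n * n + 4 * n + 4 := by ring
  have hA : n * n + 1 ≤ (n + 2) ^ 2 := by linarith [hsq2]
  have hB : (n + 2) ^ 2 ≤ (n + 2) ^ (a + 2) := Nat.pow_le_pow_right h2 (by omega)
  have hC : (n + 2) ^ a ≤ (n + 2) ^ (a + 2) := Nat.pow_le_pow_right h2 (by omega)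
  have hX : (s + n * n + 1) * (n + 2) ≤ 2 * (n + 2) ^ (a + 2) * (n + 2) :=
    Nat.mul_le_mul_right _ (by linarith)
  have h8 : 8 ≤ (n + 2) ^ 3 := by
    calc 8 = 2 ^ 3 := by norm_num
      _ ≤ (n + 2) ^ 3 := Nat.pow_le_pow_left (by omega) 3
  have hsq : n + 2 ≤ n * n := by nlinarith [Nat.mul_le_mul_right n hn]
  calc ((s + n * n + 1) * (n + 2)) ^ 3
      ≤ (2 * (n + 2) ^ (a + 2) * (n + 2)) ^ 3 := Nat.pow_le_pow_left hX 3
    _ = 8 * (n + 2) ^ (3 * a + 9) := by ring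
    _ ≤ (n + 2) ^ 3 * (n + 2) ^ (3 * a + 9) := Nat.mul_le_mul_right _ h8
    _ = (n + 2) ^ (3 * a + 12) := by ring
    _ ≤ (n * n) ^ (3 * a + 12) := Nat.pow_le_pow_left hsq _
    _ = n ^ (6 * a + 24) := by ring

/-- **Rung one in the door's currency (i.o., past any threshold)**: for all `a m₀` some
`n ≥ m₀` has `(n+2)^a < homDepthFourCircuitSize (per_n)` (GATES of homogeneous `ΣΠΣΠ`
circuits; crux `Depth4HomFour` asks for the slope `c·⌊√n⌋ + c`, here it is the constant `a`):
`perHard_io` at product-depth `2`, exponent `6a+24`, threshold `max m₀ 2`.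
VP-saturated (`IMM`/`det` obey the same bound); 0 S-currency.
[cite: LimayeSrinivasanTavenas2025, Cor. 4] [cite: KumarSaraf2017, §3] -/
theorem homDepthFour_perPoly_io (a m₀ : ℕ) :
    ∃ n, m₀ ≤ n ∧ (n + 2 : ℕ∞) ^ a < homDepthFourCircuitSize (perPoly (Fin n) ℂ) := by
  classical
  obtain ⟨n, hn, hhard⟩ :=
    DefinabilityGapK1ConstDepthRung.perHard_io (Δ₁ := 2) one_le_two (6 * a + 24) (max m₀ 2)
  have hn2 : 2 ≤ n := (le_max_right _ _).trans hn
  refine ⟨n, (le_max_left _ _).trans hn, ?_⟩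
  by_contra hlt
  rw [not_lt] at hlt
  have hle : homDepthFourCircuitSize (perPoly (Fin n) ℂ) ≤ (((n + 2) ^ a : ℕ) : ℕ∞) := by
    exact_mod_cast hlt
  obtain ⟨P, hPc, hP4, hPh, hPs⟩ := exists_circuit_of_homDepthFourCircuitSize_le hle
  have hper : (perPoly (Fin n) ℂ).IsHomogeneous n := by
    have h' := perPoly_isHomogeneous (n := Fin n) (k := ℂ)
    rwa [Fintype.card_fin] at h'
  obtain ⟨C, hCc, hCd, hCe⟩ := exists_productDepth_two_of_homDepthFour hPc hP4 hPh hper hn2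
  have hcard : Fintype.card (Fin n × Fin n) = n * n := by simp
  rw [hcard] at hCe
  exact lt_irrefl _ (lt_of_le_of_lt (Nat.le_add_right _ _)
    ((hhard C hCc hCd).trans_le (hCe.trans (rung_arith hn2 hPs))))

/-- **Rung one in the door's currency** in the binder shape of `Depth4HomFour` (constant slope
`a`). [cite: LimayeSrinivasanTavenas2025, Cor. 4] [cite: KumarSaraf2017, §3] -/
theorem homDepthFour_perPoly_gt_pow (a : ℕ) :
    ∃ n : ℕ, (n + 2 : ℕ∞) ^ a < homDepthFourCircuitSize (perPoly (Fin n) ℂ) := by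
  obtain ⟨n, -, h⟩ := homDepthFour_perPoly_io a 0
  exact ⟨n, h⟩

end Summit.ValiantsHypothesis.ValiantsHypothesis.Theorems.Depth4HomFourRung

end
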